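import Literature.InformationTheory.Entropy.VonNeumannEntropyInequalities
import Mathlib.LinearAlgebra.Matrix.Charpoly.Basic
import HarnessLib

/-!
# Zero-padding a matrix from a coordinate subtype: traces, positivity, entropy

Topic `Literature/LinearAlgebra/Matrix`. For a decidable predicate `p` on a finite index type `ι` and a
matrix `M` indexed by the subtype `{i // p i}`, `padSubtype p M` is the `ι × ι` matrix equal to `M` on
the coordinate block `p × p` and `0` elsewhere — `M ⊕ 0` along `ι ≃ {p} ⊕ {¬p}`
(`Matrix.reindex (Equiv.sumCompl p)` of `Matrix.fromBlocks M 0 0 0`). This is how a density matrix of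
a symmetry SECTOR (a canonical Gibbs state `P_K e^{−βH} / Z_K`, a fixed-particle-number ground-state
projector, …) is regarded as a density matrix of the whole space. Recorded, all PROVED:

* entries (`padSubtype_apply_of_pos`, `…_of_not_left/right`), the compression back
  (`submatrix_padSubtype`);
* duality of traces `tr(pad M · Y) = tr(M · Y|_p)` (`trace_padSubtype_mul`), `tr(pad M) = tr M`;
* `pad M` is Hermitian / positive semidefinite with `M`;
* the von Neumann entropy is unchanged: `S(pad M) = S(M)` (the spectrum gains only zeros:
  `charpoly(M ⊕ 0) = charpoly(M) · X^k`, `η(0) = 0`).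

References: Nielsen–Chuang §2.4 (block/direct-sum bookkeeping of density operators), Thm. 11.8;
Bratteli–Robinson II §5.3.1 (canonical Gibbs states as density matrices). Mathlib: `Equiv.sumCompl`,
`Matrix.fromBlocks`, `Matrix.charpoly_fromBlocks_zero₁₂`, `Matrix.charpoly_zero`, `Polynomial.roots_mul`.
-/

noncomputable section

open Matrix Polynomial
open scoped ComplexOrder
open Literature.InformationTheory.Entropy (vonNeumannEntropy vonNeumannEntropy_eq_sum_roots_charpoly
  vonNeumannEntropy_submatrix_equiv)

namespace Literature.LinearAlgebra.Matrix

variable {ι : Type*} (p : ι → Prop) [DecidablePred p]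

/-- **Zero-padding from a coordinate subtype**: `pad M = M ⊕ 0` along `ι ≃ {i // p i} ⊕ {i // ¬ p i}`.
[cite: NielsenChuang2010, §2.4.3 eqs. (2.177)–(2.182)] -/
def padSubtype (M : Matrix (Subtype p) (Subtype p) ℂ) : Matrix ι ι ℂ :=
  Matrix.reindex (Equiv.sumCompl p) (Equiv.sumCompl p) (Matrix.fromBlocks M 0 0 0)

variable {p}

/-- Entries inside the block. [cite: NielsenChuang2010, §2.4.3 eqs. (2.177)–(2.182)] -/
theorem padSubtype_apply_of_pos (M : Matrix (Subtype p) (Subtype p) ℂ) {i j : ι} (hi : p i) (hj : p j) :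
    padSubtype p M i j = M ⟨i, hi⟩ ⟨j, hj⟩ := by
  rw [padSubtype, Matrix.reindex_apply, Matrix.submatrix_apply, Equiv.sumCompl_symm_apply_of_pos hi,
    Equiv.sumCompl_symm_apply_of_pos hj, Matrix.fromBlocks_apply₁₁]

/-- Entries with a row index outside the block vanish. [cite: NielsenChuang2010, §2.4.3 eqs. (2.177)–(2.182)] -/
theorem padSubtype_apply_of_not_left (M : Matrix (Subtype p) (Subtype p) ℂ) {i : ι} (hi : ¬ p i) (j : ι) :
    padSubtype p M i j = 0 := by
  rw [padSubtype, Matrix.reindex_apply, Matrix.submatrix_apply, Equiv.sumCompl_symm_apply_of_neg hi]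
  by_cases hj : p j
  · rw [Equiv.sumCompl_symm_apply_of_pos hj, Matrix.fromBlocks_apply₂₁, Matrix.zero_apply]
  · rw [Equiv.sumCompl_symm_apply_of_neg hj, Matrix.fromBlocks_apply₂₂, Matrix.zero_apply]

/-- Entries with a column index outside the block vanish. [cite: NielsenChuang2010, §2.4.3 eqs. (2.177)–(2.182)] -/
theorem padSubtype_apply_of_not_right (M : Matrix (Subtype p) (Subtype p) ℂ) (i : ι) {j : ι} (hj : ¬ p j) :
    padSubtype p M i j = 0 := by
  rw [padSubtype, Matrix.reindex_apply, Matrix.submatrix_apply, Equiv.sumCompl_symm_apply_of_neg hj]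
  by_cases hi : p i
  · rw [Equiv.sumCompl_symm_apply_of_pos hi, Matrix.fromBlocks_apply₁₂, Matrix.zero_apply]
  · rw [Equiv.sumCompl_symm_apply_of_neg hi, Matrix.fromBlocks_apply₂₂, Matrix.zero_apply]

/-- **Compressing back recovers `M`**: `(pad M)|_p = M`. [cite: NielsenChuang2010, §2.4.3 eqs. (2.177)–(2.182)] -/
theorem submatrix_padSubtype (M : Matrix (Subtype p) (Subtype p) ℂ) :
    (padSubtype p M).submatrix (Subtype.val : Subtype p → ι) Subtype.val = M := by
  ext a b
  rw [Matrix.submatrix_apply, padSubtype_apply_of_pos M a.2 b.2]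

/-- **Duality of traces**: `tr(pad M · Y) = tr(M · Y|_p)` for every `Y` — the padded matrix represents,
as a density matrix of the whole space, the state `Y ↦ tr(M Y|_p)` of the sector.
[cite: NielsenChuang2010, §2.4.3 eqs. (2.177)–(2.182)] -/
theorem trace_padSubtype_mul [Fintype ι] (M : Matrix (Subtype p) (Subtype p) ℂ) (Y : Matrix ι ι ℂ) :
    (padSubtype p M * Y).trace = (M * Y.submatrix (Subtype.val : Subtype p → ι) Subtype.val).trace := by
  classical
  simp only [Matrix.trace, Matrix.diag_apply, Matrix.mul_apply, Matrix.submatrix_apply]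
  -- split the outer sum over `p` / `¬ p`
  rw [← Fintype.sum_equiv (Equiv.sumCompl p) (fun x => ∑ j, padSubtype p M (Equiv.sumCompl p x) j *
      Y j (Equiv.sumCompl p x)) (fun i => ∑ j, padSubtype p M i j * Y j i) (fun _ => rfl),
    Fintype.sum_sum_type]
  simp only [Equiv.sumCompl_apply_inl, Equiv.sumCompl_apply_inr]
  have h2 : ∑ b : {i // ¬ p i}, ∑ j, padSubtype p M (b : ι) j * Y j b = 0 :=
    Finset.sum_eq_zero fun b _ => Finset.sum_eq_zero fun j _ => by
      rw [padSubtype_apply_of_not_left M b.2, zero_mul]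
  rw [h2, add_zero]
  refine Finset.sum_congr rfl fun a _ => ?_
  -- split the inner sum over `p` / `¬ p`
  rw [← Fintype.sum_equiv (Equiv.sumCompl p) (fun x => padSubtype p M a (Equiv.sumCompl p x) *
      Y (Equiv.sumCompl p x) a) (fun j => padSubtype p M a j * Y j a) (fun _ => rfl),
    Fintype.sum_sum_type]
  simp only [Equiv.sumCompl_apply_inl, Equiv.sumCompl_apply_inr]
  have h3 : ∑ b : {i // ¬ p i}, padSubtype p M (a : ι) b * Y b a = 0 :=
    Finset.sum_eq_zero fun b _ => by rw [padSubtype_apply_of_not_right M _ b.2, zero_mul]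
  rw [h3, add_zero]
  refine Finset.sum_congr rfl fun b _ => ?_
  rw [padSubtype_apply_of_pos M a.2 b.2]

/-- `tr(pad M) = tr M`. [cite: NielsenChuang2010, §2.4.3 eqs. (2.177)–(2.182)] -/
theorem trace_padSubtype [Fintype ι] [DecidableEq ι] (M : Matrix (Subtype p) (Subtype p) ℂ) :
    (padSubtype p M).trace = M.trace := by
  have h := trace_padSubtype_mul M 1
  rw [Matrix.mul_one] at h
  rw [h]
  congr 1
  have h1 : (1 : Matrix ι ι ℂ).submatrix (Subtype.val : Subtype p → ι) (Subtype.val : Subtype p → ι) = 1 := by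
    ext a b
    simp only [Matrix.submatrix_apply, Matrix.one_apply, Subtype.val_inj]
  rw [h1, Matrix.mul_one]

/-- `pad M` is Hermitian when `M` is. [cite: NielsenChuang2010, §2.4.3 eqs. (2.177)–(2.182)] -/
theorem isHermitian_padSubtype {M : Matrix (Subtype p) (Subtype p) ℂ} (hM : M.IsHermitian) :
    (padSubtype p M).IsHermitian := by
  have hB : (Matrix.fromBlocks M (0 : Matrix (Subtype p) {i // ¬ p i} ℂ) 0 (0 : Matrix {i // ¬ p i} {i // ¬ p i} ℂ)).IsHermitian :=
    Matrix.IsHermitian.fromBlocks hM (by simp) Matrix.isHermitian_zero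
  unfold padSubtype
  exact hB.submatrix _

/-- Quadratic form of `M ⊕ 0`: only the block contributes. [folklore] -/
private theorem star_dotProduct_fromBlocks_mulVec [Fintype ι] (M : Matrix (Subtype p) (Subtype p) ℂ)
    (x : Subtype p ⊕ {i // ¬ p i} → ℂ) :
    star x ⬝ᵥ (Matrix.fromBlocks M (0 : Matrix (Subtype p) {i // ¬ p i} ℂ) 0
        (0 : Matrix {i // ¬ p i} {i // ¬ p i} ℂ) *ᵥ x) =
      star (x ∘ Sum.inl) ⬝ᵥ (M *ᵥ (x ∘ Sum.inl)) := by
  rw [Matrix.fromBlocks_mulVec]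
  simp only [Matrix.zero_mulVec, add_zero]
  have hstar : star x = Sum.elim (star (x ∘ Sum.inl)) (star (x ∘ Sum.inr)) := by
    funext y
    cases y <;> rfl
  rw [hstar, sumElim_dotProduct_sumElim, dotProduct_zero, add_zero]

/-- `pad M` is positive semidefinite when `M` is. [cite: NielsenChuang2010, §2.4.3 eqs. (2.177)–(2.182)] -/
theorem posSemidef_padSubtype [Fintype ι] {M : Matrix (Subtype p) (Subtype p) ℂ} (hM : M.PosSemidef) :
    (padSubtype p M).PosSemidef := by
  have hB : (Matrix.fromBlocks M (0 : Matrix (Subtype p) {i // ¬ p i} ℂ) 0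
      (0 : Matrix {i // ¬ p i} {i // ¬ p i} ℂ)).PosSemidef := by
    refine Matrix.PosSemidef.of_dotProduct_mulVec_nonneg
      (Matrix.IsHermitian.fromBlocks hM.1 (by simp) Matrix.isHermitian_zero) fun x => ?_
    rw [star_dotProduct_fromBlocks_mulVec]
    exact hM.dotProduct_mulVec_nonneg _
  unfold padSubtype
  exact hB.submatrix _

/-- Trace of a block matrix (diagonal blocks). [folklore] -/
private theorem trace_fromBlocks' {m n : Type*} [Fintype m] [Fintype n] (A : Matrix m m ℂ)
    (B : Matrix m n ℂ) (C : Matrix n m ℂ) (D : Matrix n n ℂ) :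
    (Matrix.fromBlocks A B C D).trace = A.trace + D.trace := by
  simp [Matrix.trace, Fintype.sum_sum_type]

/-- **The entropy is unchanged by zero-padding**: `S(pad M) = S(M)` for Hermitian `M` (the
characteristic polynomial gains the factor `X^k`, whose roots contribute `η(0) = 0`).
[cite: NielsenChuang2010, Theorem 11.8 (1) p.513] -/
theorem vonNeumannEntropy_padSubtype [Fintype ι] [DecidableEq ι] {M : Matrix (Subtype p) (Subtype p) ℂ}
    (hM : M.IsHermitian) :
    vonNeumannEntropy (padSubtype p M) = vonNeumannEntropy M := by
  have hB : (Matrix.fromBlocks M (0 : Matrix (Subtype p) {i // ¬ p i} ℂ) 0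
      (0 : Matrix {i // ¬ p i} {i // ¬ p i} ℂ)).IsHermitian :=
    Matrix.IsHermitian.fromBlocks hM (by simp) Matrix.isHermitian_zero
  have h1 : vonNeumannEntropy (padSubtype p M) =
      vonNeumannEntropy (Matrix.fromBlocks M (0 : Matrix (Subtype p) {i // ¬ p i} ℂ) 0
        (0 : Matrix {i // ¬ p i} {i // ¬ p i} ℂ)) := by
    unfold padSubtype
    rw [Matrix.reindex_apply]
    exact vonNeumannEntropy_submatrix_equiv hB _
  rw [h1, vonNeumannEntropy_eq_sum_roots_charpoly hB, vonNeumannEntropy_eq_sum_roots_charpoly hM,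
    Matrix.charpoly_fromBlocks_zero₁₂, Matrix.charpoly_zero]
  have hne : M.charpoly * (X : ℂ[X]) ^ Fintype.card {i // ¬ p i} ≠ 0 :=
    mul_ne_zero (Matrix.charpoly_monic M).ne_zero (pow_ne_zero _ Polynomial.X_ne_zero)
  rw [Polynomial.roots_mul hne, Polynomial.roots_X_pow, Multiset.map_add, Multiset.sum_add,
    Multiset.map_nsmul, Multiset.map_singleton, Multiset.sum_nsmul, Multiset.sum_singleton]
  simp

end Literature.LinearAlgebra.Matrix

end
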